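import Summits.KontsevichZagierPeriods.Zeta5Search.RVFlatGaugeWindowLemmas
import Summits.KontsevichZagierPeriods.Zeta5Search.CasoratianLawNoMultipole
import HarnessLib.Audit
import HarnessLib

/-!
# RVFlatGaugeWindow — the FLAT `S₇`-gauge law (28)–(30) PROVED on the one-long-block window (fam-rv gen 7, file 2/2)

HONEST FRAMING: systematic search; no irrationality claim unless certified.  This file PROVES, in a stated regime, a
statement MINTED BY THIS CELL (`RVFlatGauge.FlatGaugeLaw` / `FlatGaugeLaw28`, `@[conjecture]`, OBSERVED — fam-rv gen 4);
nothing minted here is cited as fact, and no γ / irrationality-measure claim is made.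

WHAT IS PROVED (kernel-checked, no placeholders).
* `Window.gauge_le_cv_of_window` (LEMMA A).  `c` in the polytope, `p ≥ 5` prime, `c₀ + 2 < p²`, all seven lower
  parameters `c₁..c₇ < p`, and every block `c₀ − 2c_k` short (`< p`) except possibly ONE  ⟹
  `−e_D♭(c,p) − v_p ρ(c) ≤ min(1,⌊d/p⌋) − N_p(c)`  (flat `S₇`-gauge bound ≤ the Chudnovsky–(CV) bound).
* `flatGaugeLaw28_of_window` (THEOREM W-28).  LEMMA A + the tree's (CV) theorems `casoratianLaw_of_noMultipole`,
  `classPoleCount_le_one_of_short_blocks`  ⟹  `−e_D♭(b,p) − v_p ρ(b) ≤ v_p C_j(b)` on that window (`b + e_j` in the polytope,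
  `C_j(b) ≠ 0`) — i.e. `FlatGaugeLaw28` restricted to the window.
* `flatGaugeLaw_of_window` (THEOREM W).  The same with `ρ(σ•b)` for ALL `σ ∈ S₇` — `FlatGaugeLaw` on the window (the window
  only mentions `b₀` and the multiset `{b₁,…,b₇}`, so W-28 transports along `σ` by `casoratianPermSymmetry_holds`,
  `shift_permLower`, `inPolytope_permLower`, `eDflat_permLower`, exactly as in `flatGaugeLaw_of_flatGaugeLaw28`).
* `Window.hyps_of_m1_lt`.  `p > m₁(b)` lies in the window (every form `≤ m₁ < p`; a block avoiding a minimal slot is `≤` a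
  pair form; `b₀ ≤ 3m₁` gives `b₀ + 2 < p²`), so W contains the whole `p > m₁` regime — fam-rv gen-6's
  `flatGaugeLaw_of_m1_lt` (tree `RVFlatGaugeBeyondM1Lemmas` landed, `RVFlatGaugeBeyondM1` filed) — as the special case
  with no long block off the minimal slot; that theorem is not re-stated here.
* `recordRayFlat_upper`.  On the Brown–Zudilin record ray `b = n·(41;17,…,11)` the window is `p > 17n` — every `n ≥ 1`, every
  direction `j`, every `σ` — one unit of primes `(17n, 18n]` below `p > m₁ = 18n`, and exactly the range of the tree's
  `recordRayCV_upper`.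
* `FlatGaugeLawWindow` (typed node) := `FlatGaugeLaw` with `m₁ < p²` replaced by the window hypotheses;
  `flatGaugeLawWindow_holds` PROVES it; `flatGaugeLawWindow_of_flatGaugeLaw` is the trivial edge from the conjecture node.
NOT proved: `FlatGaugeLaw` / `FlatGaugeLaw28` off the window (a lower parameter `≥ p`, or two long blocks) — still OBSERVED.

PROOF OF LEMMA A (paper version; the Lean follows it literally).  All `c_i < p` makes the five `c_i!` of ρ's denominator
units and, with `c₀ + 2 < p²`, Legendre below `p²` gives `v_p ρ(c) = Σ_{(j,k)∈E} ⌊(c₀−c_j−c_k)/p⌋ − ⌊d/p⌋`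
(`Window.padicValRat_rhoB_smallParams`; `E` = gen-1's fifteen numerator pairs).  So `gauge − cv =
(nonESum + ⌊d/p⌋) − (e_D♭ + min(1,⌊d/p⌋))` where `nonESum` runs over the six pairs NOT in `E`; these form a Hamiltonian
PATH of `K₇`.  With one long block at slot `i`: a non-`E` floor is `≤ 1` (its form is `< 2p`), it VANISHES unless the pair
meets `i` (two short blocks ⟹ form `< p`), and at most two path edges meet `i`; every unit among them is a DISTINCT form
`≥ p` among the 28, hence charged by the top-four part `T4 = e_D − ⌊log_p m₅⌋` of the exponent (`one_le_T4`, `two_le_T4`):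
`nonESum ≤ T4`.  The six short blocks sum to `≤ 6(p−1)`, whence `d < 3p ≤ p²` and `v_p(d!) = ⌊d/p⌋ ∈ {0,1,2}`: one unit is
the refund `min(1,⌊d/p⌋)`, and when `⌊d/p⌋ = 2` the second is paid by the FLAT fifth modulus — `2p ≤ d ⟹ m₅♭ ≥ ⌊d/2⌋ ≥ p
⟹ ⌊log_p m₅♭⌋ ≥ 1` — the only place `m₅♭ ≠ m₅` matters, matching fam-rv gen-4's observation that every violation of the
un-flattened bound sits at a prime with `2p ≤ d`.

WHERE THE WINDOW SITS — numbers (exact arithmetic; fam-rv gen-7 `HOME/pub-zeta5-fam-rv/gen7/rv7_window.py`,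
`rv7_exh.py`, outputs `gen7/out/*.json`; engine = census g13 `gaugecone` + gen-1 `dictionary.forms_dual`; `gauge` :=
`−e_D♭ − min_σ v_p ρ(σ•b)`, `cv` := `min(1,⌊d/p⌋) − N_p`; zones at a prime `p ≥ 5`: A `p > m₁`; B `L < p ≤ m₁` with
`L := b₀ − 2b₍₂₎`, `b₍₂₎` the second-smallest lower parameter (⟺ at most one long block); C `p ≤ L` (two long blocks)):
* EXHAUSTIVE `b₀ ∈ [6,14]` — 2,686 polytope vectors, every admissible `j`, every zone-B prime: 9,846 instances, 0 FLAT
  violations, 0 (CV) violations; on the window (all `b_i < p`: 8,208 instances) `gauge > cv` NEVER occurs (0; `gauge = cv`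
  in 5,303, `<` in 2,905) and the unpermuted gauge already attains the minimum over σ (8,208/8,208); OFF the window inside
  zone B (some `b_i ≥ p`: 1,638 instances) `gauge > cv` in 516 (e.g. `b = (10; 5,5,5,5,5,4,0)`, `j = 6`, `p = 5`:
  `v_p C_j = −5 = gauge > cv = −6`);
* RANDOM 4,000 vectors, `b₀ ≤ 40` (seed 71): zone A 54,774 instances, `gauge = cv` in all; zone B 1,648: `gauge > cv` in 34,
  every one with some `b_i ≥ p` (0 of the 1,525 window instances), e.g. `b = (12; 4,0,6,5,4,6,5)`, `j = 5`, `p = 5`: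
  `v_p C_j = −4 = gauge > cv = −5`; zone C 19,401: `gauge > cv` in 12,966; 0 FLAT violations in every zone;
* RANDOM 2,500 vectors, `b₀ ≤ 64` (seed 73): A 45,563 (`gauge = cv` in all); B 1,414: `gauge > cv` in 22 (0 of the 1,330
  window instances); C 17,915: `gauge > cv` in 12,493; 0 FLAT / (CV) violations.
So THEOREM W is the exact extent of "FLAT ⊆ (CV)": outside the window (a lower parameter `≥ p`, or two long blocks) the
flat law is strictly STRONGER than (CV) on a positive fraction of rows and stays OBSERVED — 0 violations in the 150,561
instances of these three tables, in gen-4's 135,172, and in the ttrl2 `zeta5-calc` lane's 698,554 (20,000 random polytope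
vectors `b₀ ≤ 96`, FLAT tight in 641,498; `run/shared/lean/ttrl/zeta5-calc/rv/FLATCONE.md`, sha256 `a29aaae2…`) — NOT proved; proving it there needs digit-level input beyond (CV) (census
`CVBlockReduction`: `MultiBlockLaw`, `MixedPairLaw`, both open).

VALUE (numbers, not adjectives).  γ: 0.000 — on the record ray and on every NEAR-MISSES ray the window primes already had
(CV) as a tree theorem, and the record's proved exponent stays `γ = 0.85488` (vs Brown–Zudilin's `0.86597` with the
OBSERVED (28)–(30)).  Structural (T1/T3): Brown–Zudilin's (28)–(30) for all 5040 labellings is now a THEOREM at every prime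
of the window (on the record ray: every `p > 17n`, all `n` — the (CV) range), the `p > m₁` theorem is a corollary, and the
complement where (FLAT) is genuinely stronger than (CV) is located exactly (above).
-/

namespace Summit.KontsevichZagierPeriods.Zeta5Search.RVFlatGauge

open Finset
open Summit.KontsevichZagierPeriods.Zeta5Search.CasoratianValuation (casoratian shift InPolytope pairFloors refund)
open Summit.KontsevichZagierPeriods.Zeta5Search.WedgeDictionary (dOf Epairs)
open Summit.KontsevichZagierPeriods.Zeta5Search.SymmetricGauge
open Summit.KontsevichZagierPeriods.Zeta5Search.DualSeries (InBox)

namespace Window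
/-! ### The window inequality -/

/-- **LEMMA A (one long block, small lower parameters).** If `c` lies in the polytope, `p ≥ 5` is a prime with
`c₀ + 2 < p²`, all seven lower parameters are `< p` and at most ONE block `c₀ − 2c_{k}` is `≥ p`, then the flat
`S₇`-gauge bound is at most the Chudnovsky-type bound: `−e_D♭(c) − v_p ρ(c) ≤ refund − N_p(c)`.
Proof: the six non-`E` pair floors are `≤ 1`, vanish off the star of the long block and form a path (`≤ 2` of them meet
the long slot), each unit among them is a distinct form `≥ p` charged by `e_D − ⌊log_p m₅⌋`; `d < 3p` so `v_p(d!) = ⌊d/p⌋ ≤ 2`,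
paid by the refund (`⌊d/p⌋ = 1`) or by refund + flat fifth modulus (`⌊d/p⌋ = 2 ⇒ m₅♭ ≥ ⌊d/2⌋ ≥ p`). -/
theorem gauge_le_cv_of_window (c : ℕ → ℤ) {p : ℕ} (hc : InPolytope c) (hp : p.Prime) (hp5 : 5 ≤ p)
    (hwin : (c 0 + 2 : ℤ) < (p : ℤ) ^ 2) {i : ℕ}
    (hshort : ∀ k ∈ (range 7).erase i, c 0 - 2 * c (k + 1) < p)
    (hsmall : ∀ k ∈ range 7, c (k + 1) < p) :
    -eDflat c p - padicValRat p (rhoB c) ≤ refund c p - pairFloors c p := by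
  have hp1 : 1 < p := hp.one_lt
  have hp0 : (0 : ℤ) < p := by exact_mod_cast hp.pos
  have hp2 : p ≠ 2 := by omega
  obtain ⟨⟨h00, hbox⟩, hhalf, hsum⟩ := id hc
  have hnn : ∀ k, k < 7 → 0 ≤ c (k + 1) ∧ 2 * c (k + 1) ≤ c 0 ∧ c (k + 1) < p := fun k hk =>
    ⟨(hbox k (mem_range.2 hk)).1, hhalf k (mem_range.2 hk), hsmall k (mem_range.2 hk)⟩
  -- normalise the long-block index into `range 7`
  obtain ⟨i, hi7, hblk⟩ : ∃ i', i' < 7 ∧ ∀ k, k < 7 → k ≠ i' → c 0 - 2 * c (k + 1) < (p : ℤ) := by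
    by_cases hi : i < 7
    · exact ⟨i, hi, fun k hk hki => hshort k (mem_erase.2 ⟨hki, mem_range.2 hk⟩)⟩
    · exact ⟨0, by norm_num, fun k hk _ => hshort k (mem_erase.2 ⟨by omega, mem_range.2 hk⟩)⟩
  -- `0 ≤ d < 3p`
  have hd0 : 0 ≤ dOf c := by unfold dOf; linarith
  have hd3 : dOf c < 3 * (p : ℤ) := by
    have h6 : ∑ k ∈ (range 7).erase i, (c 0 - 2 * c (k + 1)) ≤ 6 * ((p : ℤ) - 1) := by
      have h := Finset.sum_le_card_nsmul ((range 7).erase i) (fun k => c 0 - 2 * c (k + 1)) ((p : ℤ) - 1)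
        (fun k hk => by
          have hk' := mem_erase.1 hk
          have := hblk k (mem_range.1 hk'.2) hk'.1
          show c 0 - 2 * c (k + 1) ≤ (p : ℤ) - 1
          omega)
      rw [card_erase_of_mem (mem_range.2 hi7), card_range] at h
      simpa [nsmul_eq_mul] using h
    have hsplit := Finset.sum_erase_eq_sub (f := fun k => c 0 - 2 * c (k + 1)) (mem_range.2 hi7)
    have hall : ∑ k ∈ range 7, (c 0 - 2 * c (k + 1)) = 7 * c 0 - 2 * ∑ k ∈ range 7, c (k + 1) := by
      rw [Finset.sum_sub_distrib, Finset.sum_const, card_range, ← Finset.mul_sum]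
      simp
    have hci := (hnn i hi7).1
    rw [hsplit, hall] at h6
    unfold dOf
    linarith
  have hp3 : (3 : ℤ) ≤ p := by exact_mod_cast (by omega : 3 ≤ p)
  have hdp : dOf c < (p : ℤ) ^ 2 := by nlinarith
  -- `t := ⌊d/p⌋ ∈ {0,1,2}`
  have ht0 : 0 ≤ dOf c / (p : ℤ) := Int.ediv_nonneg hd0 hp0.le
  have ht2 : dOf c / (p : ℤ) ≤ 2 := by
    have := (Int.ediv_lt_iff_lt_mul hp0).2 (show dOf c < 3 * (p : ℤ) from hd3)
    omega
  -- the valuation of `ρ` and the split of the pair floors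
  have hval := padicValRat_rhoB_smallParams hc hp hp2 hwin hdp hsmall
  have hpf := pairFloors_eq_eSum_add c p
  -- termwise facts on the six non-`E` floors
  have hf1 : ∀ x ∈ nonE, pf c p x ≤ 1 := by
    intro x hx
    obtain ⟨hx1, hx2, hlt⟩ := nonE_bounds x hx
    obtain ⟨ha0, ha2, hap⟩ := hnn x.1 hx1
    obtain ⟨hb0, hb2, hbp⟩ := hnn x.2 hx2
    have hform : c 0 - c (x.1 + 1) - c (x.2 + 1) < 2 * (p : ℤ) := by
      by_cases h1 : x.1 = i
      · have := hblk x.2 hx2 (by omega); omega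
      · have := hblk x.1 hx1 h1; omega
    have := (Int.ediv_lt_iff_lt_mul hp0).2 hform
    unfold pf; omega
  have hf0 : ∀ x ∈ nonE, ¬ (x.1 = i ∨ x.2 = i) → pf c p x = 0 := by
    intro x hx hxi
    rw [not_or] at hxi
    obtain ⟨hx1, hx2, hlt⟩ := nonE_bounds x hx
    have h1 := hblk x.1 hx1 hxi.1
    have h2 := hblk x.2 hx2 hxi.2
    obtain ⟨ha0, ha2, _⟩ := hnn x.1 hx1
    obtain ⟨hb0, hb2, _⟩ := hnn x.2 hx2
    unfold pf
    exact Int.ediv_eq_zero_of_lt (by omega) (by omega)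
  have hfp : ∀ x ∈ nonE, 1 ≤ pf c p x → (p : ℤ) ≤ c 0 - c (x.1 + 1) - c (x.2 + 1) := by
    intro x hx h1
    unfold pf at h1
    have := (Int.le_ediv_iff_mul_le hp0).1 h1
    linarith
  -- `A` := the non-`E` pairs charging a unit: at most two, all through the long slot, each a form `≥ p`
  set A := nonE.filter (fun x => 1 ≤ pf c p x) with hA
  have hAsub : A ⊆ nonE.filter (fun x => x.1 = i ∨ x.2 = i) := by
    intro x hx
    rw [hA, mem_filter] at hx
    rw [mem_filter]
    refine ⟨hx.1, ?_⟩
    by_contra hxi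
    have := hf0 x hx.1 hxi
    omega
  have hAcard : A.card ≤ 2 := (card_le_card hAsub).trans (card_nonE_filter_le hi7)
  have hsumA : nonESum c p ≤ (A.card : ℤ) := by
    have hsplit := Finset.sum_filter_add_sum_filter_not nonE (fun x => 1 ≤ pf c p x) (pf c p)
    unfold nonESum
    rw [← hsplit]
    have h1 := Finset.sum_le_card_nsmul (nonE.filter (fun x => 1 ≤ pf c p x)) (pf c p) 1
      fun x hx => hf1 x (mem_filter.1 hx).1
    have h2 : ∑ x ∈ nonE.filter (fun x => ¬ 1 ≤ pf c p x), pf c p x ≤ 0 :=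
      Finset.sum_nonpos fun x hx => by have := (mem_filter.1 hx).2; omega
    simp only [nsmul_eq_mul, mul_one] at h1
    rw [hA]
    linarith
  -- the sorted list of the 28 forms and its top-four charge
  set S := (forms28 c).insertionSort (· ≥ ·) with hS
  have hSsort : S.Pairwise (· ≥ ·) := List.pairwise_insertionSort _ _
  have hcountS : S.countP (fun y => decide ((p : ℤ) ≤ y)) =
      scheme.countP ((fun y => decide ((p : ℤ) ≤ y)) ∘ ev c) := by
    rw [hS, (List.perm_insertionSort (· ≥ ·) (forms28 c)).countP_eq, forms28_eq_scheme, List.countP_map]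
  have hmemS : ∀ x ∈ A, idxOf x ∈ scheme ∧ ((fun y => decide ((p : ℤ) ≤ y)) ∘ ev c) (idxOf x) = true := by
    intro x hx
    obtain ⟨hxn, hx1⟩ := mem_filter.1 hx
    refine ⟨idxOf_mem_scheme hxn, ?_⟩
    simp only [Function.comp_apply, ev_idxOf c x hxn, decide_eq_true_eq]
    exact hfp x hxn hx1
  have hT1 : 1 ≤ A.card → (1 : ℤ) ≤ T4 p S := by
    intro h
    obtain ⟨x, hx⟩ := (Finset.card_pos (s := A)).1 (by omega)
    apply one_le_T4 hp1 hSsort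
    rw [hcountS]
    obtain ⟨hm, hq⟩ := hmemS x hx
    exact List.countP_pos_iff.2 ⟨idxOf x, hm, hq⟩
  have hT2 : 2 ≤ A.card → (2 : ℤ) ≤ T4 p S := by
    intro h
    obtain ⟨x, hx, y, hy, hxy⟩ := (Finset.one_lt_card (s := A)).1 (by omega)
    apply two_le_T4 hp1 hSsort
    rw [hcountS]
    obtain ⟨hmx, hqx⟩ := hmemS x hx
    obtain ⟨hmy, hqy⟩ := hmemS y hy
    exact two_le_countP scheme _
      (fun he => hxy (idxOf_inj x (mem_filter.1 hx).1 y (mem_filter.1 hy).1 he)) hmx hmy hqx hqy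
  have hT0 := T4_nonneg p S
  have hT : nonESum c p ≤ T4 p S := by
    rcases Nat.lt_or_ge A.card 1 with h0 | h1
    · have : (A.card : ℤ) ≤ 0 := by exact_mod_cast (by omega : A.card ≤ 0)
      linarith
    rcases Nat.lt_or_ge A.card 2 with h1' | h2
    · have : (A.card : ℤ) ≤ 1 := by exact_mod_cast (by omega : A.card ≤ 1)
      linarith [hT1 h1]
    · have : (A.card : ℤ) ≤ 2 := by exact_mod_cast hAcard
      linarith [hT2 h2]
  -- the flat fifth modulus pays the second unit of `v_p(d!)`
  have hflat : eDflat c p = T4 p S + (Nat.log p (m5flat c).toNat : ℤ) := by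
    rw [hS]; exact eDflat_eq_T4_add c p
  have hL5 : 0 ≤ (Nat.log p (m5flat c).toNat : ℤ) := Int.natCast_nonneg _
  have hL5' : 2 ≤ dOf c / (p : ℤ) → 1 ≤ (Nat.log p (m5flat c).toNat : ℤ) := by
    intro h
    apply one_le_log_m5flat hp1
    have h2 : 2 * (p : ℤ) ≤ dOf c := by
      have := (Int.le_ediv_iff_mul_le hp0).1 h; linarith
    exact (Int.le_ediv_iff_mul_le (by norm_num : (0 : ℤ) < 2)).2 (by linarith)
  have ht : dOf c / (p : ℤ) ≤ min 1 (dOf c / (p : ℤ)) + (Nat.log p (m5flat c).toNat : ℤ) := by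
    rcases le_or_gt (dOf c / (p : ℤ)) 1 with h | h
    · rw [min_eq_right h]; linarith
    · rw [min_eq_left h.le]; have := hL5' (by omega); omega
  have hrefund : refund c p = min 1 (dOf c / (p : ℤ)) := rfl
  rw [hflat, hval, hrefund, hpf]
  linarith

end Window

open Window

/-! ### The theorems -/

/-- **THEOREM W-28 (FLAT law (28) on the window, PROVED).**  For `b` in the polytope, an admissible direction `e_j`,
a prime `p ≥ 5` with `b₀ + 2 < p²`, all seven lower parameters `< p` and at most one long block
(`b₀ − 2b_k ≥ p` for at most one `k`): `−e_D♭(b,p) − v_p ρ(b) ≤ v_p C_j(b)`.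
(= LEMMA A + the tree's `casoratianLaw_of_noMultipole` + `classPoleCount_le_one_of_short_blocks`.) -/
theorem flatGaugeLaw28_of_window (b : ℕ → ℤ) {j p : ℕ} (hb : InPolytope b) (hj1 : 1 ≤ j) (hj7 : j ≤ 7)
    (hb' : InPolytope (shift b j)) (hp : p.Prime) (hp5 : 5 ≤ p) (hwin : (b 0 + 2 : ℤ) < (p : ℤ) ^ 2)
    {i : ℕ} (hshort : ∀ k ∈ (range 7).erase i, b 0 - 2 * b (k + 1) < p)
    (hsmall : ∀ k ∈ range 7, b (k + 1) < p) (hcas : casoratian b j ≠ 0) :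
    -eDflat b p - padicValRat p (rhoB b) ≤ padicValRat p (casoratian b j) := by
  haveI : Fact p.Prime := ⟨hp⟩
  exact (gauge_le_cv_of_window b hb hp hp5 hwin hshort hsmall).trans
    (ClusterValuation.casoratianLaw_of_noMultipole b hb hj1 hj7 hb' hp5 hwin
      (fun x _ => ClusterValuation.classPoleCount_le_one_of_short_blocks b hb hp.pos hshort x) hcas)

/-- **THEOREM W (FLAT `S₇`-gauge law for ALL 5040 labellings on the window, PROVED)** — the `∀σ` form of
`FlatGaugeLaw` restricted to the window; the window hypotheses are `S₇`-invariant (they only mention the multiset of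
lower parameters), so W-28 is transported along `σ` exactly as in `flatGaugeLaw_of_flatGaugeLaw28`. -/
theorem flatGaugeLaw_of_window (b : ℕ → ℤ) {j p : ℕ} (σ : Equiv.Perm (Fin 7)) (hb : InPolytope b)
    (hj1 : 1 ≤ j) (hj7 : j ≤ 7) (hb' : InPolytope (shift b j)) (hp : p.Prime) (hp5 : 5 ≤ p)
    (hwin : (b 0 + 2 : ℤ) < (p : ℤ) ^ 2) {i : ℕ} (hshort : ∀ k ∈ (range 7).erase i, b 0 - 2 * b (k + 1) < p)
    (hsmall : ∀ k ∈ range 7, b (k + 1) < p) (hcas : casoratian b j ≠ 0) :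
    -eDflat b p - padicValRat p (rhoB (permLower σ b)) ≤ padicValRat p (casoratian b j) := by
  -- normalise the long-block index into `range 7`
  obtain ⟨i, hi7, hblk⟩ : ∃ i', i' < 7 ∧ ∀ k, k < 7 → k ≠ i' → b 0 - 2 * b (k + 1) < (p : ℤ) := by
    by_cases hi : i < 7
    · exact ⟨i, hi, fun k hk hki => hshort k (mem_erase.2 ⟨hki, mem_range.2 hk⟩)⟩
    · exact ⟨0, by norm_num, fun k hk _ => hshort k (mem_erase.2 ⟨by omega, mem_range.2 hk⟩)⟩
  -- the index `i₀` with `σ(i₀) + 1 = j`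
  set i₀ : Fin 7 := σ.symm ⟨j - 1, by omega⟩ with hi₀
  have hσi : (σ i₀).val + 1 = j := by simp [hi₀]; omega
  have hcas' : casoratian (permLower σ b) (i₀.val + 1) = casoratian b j := by
    rw [casoratianPermSymmetry_holds b σ i₀, hσi]
  have hshift : InPolytope (shift (permLower σ b) (i₀.val + 1)) := by
    rw [shift_permLower, hσi]; exact inPolytope_permLower σ hb'
  have hne : casoratian (permLower σ b) (i₀.val + 1) ≠ 0 := by rw [hcas']; exact hcas
  have hc0 : permLower σ b 0 = b 0 := permLower_zero σ b
  have hwin' : (permLower σ b 0 + 2 : ℤ) < (p : ℤ) ^ 2 := by rw [hc0]; exact hwin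
  have hsmall' : ∀ k ∈ range 7, permLower σ b (k + 1) < (p : ℤ) := by
    intro k hk
    have hk7 := mem_range.1 hk
    have happ := permLower_apply_succ σ b ⟨k, hk7⟩
    simp only at happ
    rw [happ]
    exact hsmall _ (mem_range.2 (σ ⟨k, hk7⟩).isLt)
  -- the long block of `σ•b` sits at `σ⁻¹(i)`
  set i₁ : Fin 7 := σ.symm ⟨i, hi7⟩ with hi₁
  have hshort' : ∀ k ∈ (range 7).erase i₁.val, permLower σ b 0 - 2 * permLower σ b (k + 1) < (p : ℤ) := by
    intro k hk
    obtain ⟨hki, hk'⟩ := mem_erase.1 hk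
    have hk7 := mem_range.1 hk'
    have happ := permLower_apply_succ σ b ⟨k, hk7⟩
    simp only at happ
    rw [hc0, happ]
    refine hblk _ (σ ⟨k, hk7⟩).isLt fun heq => hki ?_
    have hσk : σ ⟨k, hk7⟩ = ⟨i, hi7⟩ := Fin.ext heq
    have := congrArg σ.symm hσk
    rw [Equiv.symm_apply_apply] at this
    rw [hi₁, ← this]
  have key := flatGaugeLaw28_of_window (permLower σ b) (inPolytope_permLower σ hb) (by omega)
    (by have := i₀.isLt; omega) hshift hp hp5 hwin' hshort' hsmall' hne
  rw [hcas', eDflat_permLower] at key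
  exact key

/-- **`p > m₁(b)` lies in the window**: every lower parameter is `< p`, every block avoiding a slot `i` where the lower
parameters attain their minimum is `< p` (it is `≤` a pair form `≤ m₁`), and `b₀ + 2 < p²` (`b₀ ≤ 3m₁`, tree
`b0_le_three_mul_m1`).  Hence THEOREM W contains the whole `p > m₁` regime — fam-rv gen-6's `flatGaugeLaw_of_m1_lt`
(`Zeta5Search/RVFlatGaugeBeyondM1.lean`) is `flatGaugeLaw_of_window` fed with these three outputs (not re-stated here). -/
theorem Window.hyps_of_m1_lt (b : ℕ → ℤ) {p : ℕ} (hp5 : 5 ≤ p) (hm : m1 b < p) {i : ℕ} (hi : i ∈ range 7)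
    (hmin : ∀ k ∈ range 7, b (i + 1) ≤ b (k + 1)) :
    (b 0 + 2 : ℤ) < (p : ℤ) ^ 2 ∧ (∀ k ∈ (range 7).erase i, b 0 - 2 * b (k + 1) < (p : ℤ)) ∧
      ∀ k ∈ range 7, b (k + 1) < (p : ℤ) := by
  have hi7 := mem_range.1 hi
  refine ⟨?_, fun k hk => ?_, fun k hk => (single_le_m1 b (mem_range.1 hk)).trans_lt hm⟩
  · have h3 := b0_le_three_mul_m1 b
    have hp3 : (3 : ℤ) ≤ p := by exact_mod_cast (by omega : 3 ≤ p)
    have : 3 * (p : ℤ) ≤ (p : ℤ) ^ 2 := by nlinarith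
    linarith
  · obtain ⟨hki, hk'⟩ := mem_erase.1 hk
    have h1 := pair_le_m1 b hi7 (mem_range.1 hk') (Ne.symm hki)
    have h2 := hmin k hk'
    linarith

/-- **RECORD RAY `b = n·(41;17,…,11)`, `p > 17n`, ALL labellings** — the window on the ray is exactly `p > 17n`
(`b₍₁₎ = 17n`; the only block that can reach `p ≤ 19n` is `b₀ − 2b₇ = 19n`; `(17n+1)² > 41n+2`), one unit of primes
below gen-6's `p > m₁ = 18n`; it is the range of the tree's `recordRayCV_upper`. -/
theorem recordRayFlat_upper (n j p : ℕ) (σ : Equiv.Perm (Fin 7)) (hn : 1 ≤ n) (hj1 : 1 ≤ j) (hj7 : j ≤ 7)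
    (hprime : p.Prime) (hp5 : 5 ≤ p) (hpn : 17 * n < p)
    (hcas : casoratian (ClusterValuation.bRec n) j ≠ 0) :
    -eDflat (ClusterValuation.bRec n) p - padicValRat p (rhoB (permLower σ (ClusterValuation.bRec n))) ≤
      padicValRat p (casoratian (ClusterValuation.bRec n) j) := by
  have h1 : (17 * n + 1 : ℤ) ≤ p := by exact_mod_cast hpn
  have hn1 : (1 : ℤ) ≤ n := by exact_mod_cast hn
  have hsq : (17 * n + 1 : ℤ) * (17 * n + 1) ≤ (p : ℤ) * p := mul_le_mul h1 h1 (by positivity) (by positivity)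
  have hwin : (ClusterValuation.bRec n 0 + 2 : ℤ) < (p : ℤ) ^ 2 := by
    simp [ClusterValuation.bRec]
    nlinarith
  refine flatGaugeLaw_of_window (ClusterValuation.bRec n) σ (ClusterValuation.inPolytope_bRec n) hj1 hj7
    (ClusterValuation.inPolytope_shift_bRec n j hn hj1 hj7) hprime hp5 hwin (i := 6) ?_ ?_ hcas
  · intro k hk
    have hk7 := mem_range.1 (mem_erase.1 hk).2
    have hki := (mem_erase.1 hk).1
    interval_cases k <;> simp [ClusterValuation.bRec] <;> omega
  · intro k hk
    have hk7 := mem_range.1 hk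
    interval_cases k <;> simp [ClusterValuation.bRec] <;> omega

/-! ### The window law as a typed node (PROVED) and its edge from the conjecture node -/

/-- **The flat `S₇`-gauge law on the window** — `FlatGaugeLaw` with `m₁ < p²` replaced by the window hypotheses
(`b₀ + 2 < p²`, all lower parameters `< p`, at most one long block `b₀ − 2b_{k+1} ≥ p`).  PROVED: `flatGaugeLawWindow_holds`. -/
def FlatGaugeLawWindow : Prop :=
  ∀ (b : ℕ → ℤ) (j p i : ℕ) (σ : Equiv.Perm (Fin 7)), InPolytope b → 1 ≤ j → j ≤ 7 → InPolytope (shift b j) →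
    p.Prime → 5 ≤ p → (b 0 + 2 : ℤ) < (p : ℤ) ^ 2 → (∀ k ∈ (range 7).erase i, b 0 - 2 * b (k + 1) < p) →
    (∀ k ∈ range 7, b (k + 1) < p) → casoratian b j ≠ 0 →
    -eDflat b p - padicValRat p (rhoB (permLower σ b)) ≤ padicValRat p (casoratian b j)

/-- **The window law HOLDS** (= `flatGaugeLaw_of_window`). -/
theorem flatGaugeLawWindow_holds : FlatGaugeLawWindow :=
  fun b _ _ _ σ hb hj1 hj7 hb' hp hp5 hwin hshort hsmall hcas =>
    flatGaugeLaw_of_window b σ hb hj1 hj7 hb' hp hp5 hwin hshort hsmall hcas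

/-- The trivial direction `FlatGaugeLaw ⇒ FlatGaugeLawWindow` (on the window `m₁ ≤ b₀ + 1 < p²`), recorded so that the
window law sits under the conjecture node; the content of this file is that the window law HOLDS. -/
theorem flatGaugeLawWindow_of_flatGaugeLaw (h : FlatGaugeLaw) : FlatGaugeLawWindow := by
  intro b j p i σ hb hj1 hj7 hb' hp hp5 hwin _ _ hcas
  exact h b j p σ hb hj1 hj7 hb' hp hp5 (by have := Window.m1_le_b0_add_one hb; linarith) hcas

/-! ### Kernel instances -/

/-- The record ray at `n = 3`: `m₁ = 54`, so `p = 53 ∈ (17n, 18n] = (51, 54]` is covered by THEOREM W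
(`recordRayFlat_upper`) and not by the `p > m₁` theorem; the window data there: lower parameters `≤ 51 < 53`, blocks
`21, 27, 39, 45, 45, 51, 57` — exactly one (`57 = b₀ − 2b₇`) is long. -/
example : m1 (ClusterValuation.bRec 3) = 54 ∧
    ((List.range 7).map fun k => ClusterValuation.bRec 3 0 - 2 * ClusterValuation.bRec 3 (k + 1)) =
      [21, 27, 33, 39, 45, 51, 57] := by decide

end Summit.KontsevichZagierPeriods.Zeta5Search.RVFlatGauge
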